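import Summits.ResolutionOfSingularities.ResolutionOfSingularities.Theorems.EquisingularLiftEquisingularLiftNatSpecimenConeForms
import Summits.ResolutionOfSingularities.ResolutionOfSingularities.Theorems.EquisingularLiftEquisingularLiftNatSpecimenFermatConeCharts
import Summits.ResolutionOfSingularities.ResolutionOfSingularities.Theorems.EquisingularLiftEquisingularLiftNatSpecimenWhitneyCubicCharts
import HarnessLib

/-!
# [OURS · L1 W4.5(b)] EL♮ specimens — CONES OVER SMOOTH PLANE CURVES: `Bl_vertex H` is regular and EL♮ holds for the cone
# `H = V₊(G(x₁,x₂,x₃)) ⊂ ℙ³_k` over every prime plane form `G` with regular affine charts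
# (crux `Theses.EquisingularLift.EquisingularLiftNat`, stmt-ResolutionOfSingularities-20038)

NOT a statement of any manuscript; OURS kernel theorem (cell `res-hironaka`, chain w45b; seat res-D-pv-013, own initiative, counted 0), the
`G`-generic form of `…SpecimenFermatConeCharts` (p518711; template res-D-pv-022's R2 `…WhitneyCubicCharts` p511043 with `(r,m) = (0,3)`).
AI-written, weaker than expert review.

INPUT: `G ∈ k[T₀,T₁,T₂]` homogeneous of degree `d`, PRIME, with the three affine charts `k[T]/(G|_{Tᵢ := 1})` REGULAR (i.e. `V₊(G) ⊂ ℙ²` a smooth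
plane curve; the hypothesis is carried as ring regularity). The cone `H = V₊(F)`, `F = rename Fin.succ G = G(x₁, x₂, x₃)`, has the vertex
`[1:0:0:0] = V(Λ)` (`Λ = ker Proj(f_k)`, kill map `(r,m) = (0,3)`) as its only singular point (an ordinary `d`-fold point).

* `isRegularRing_chartRing_of_ne_zero`, `isRegularRing_blowupAlgebra_tautVec` — chart rings off the vertex and the three blow-up charts over
  the vertex are regular (…ConeForms, …ConeVertexChart, transported along `FermatCone.exists_chartQuotEquiv`);
* `comap_chart_eq_ofIdealTop`, `isRegular_of_isBlowup_comap` — the centre on the charts; **every blow-up of `H` along `Λ · 𝒪_H` is regular**;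
* `support_subset_range`, `not_range_subset_support` — `V(Λ) ⊆ ι(H)` and `ι(H) ⊄ V(Λ)`;
* **`elNatAt_cone`** — `Theorems.EquisingularLift.ELNatAt p K 3 H ι` by ONE horizontal E1 step (the section through the vertex,
  `elNatAt_of_oneStep₀` p505461). Instances: the Fermat cones (`FermatCone.elNatAt_fermatCone`), smooth cubic cones (simple-elliptic `Ẽ₆`
  vertices), … — every ordinary cone point over a smooth plane curve.
-/

set_option linter.dupNamespace false -- mandated namespace `Summit.<Summit>.<Problem>` of this single-conjunct summit

noncomputable section

open CategoryTheory CategoryTheory.Limits AlgebraicGeometry TopologicalSpace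
open MvPolynomial HomogeneousLocalization
open Literature.AlgebraicGeometry.Resolution
open Literature.AlgebraicGeometry.Motives Literature.AlgebraicGeometry.Motives.SmoothHypersurface
open Literature.AlgebraicGeometry.Motives.ProjectiveSpace
open AlgebraicGeometry.Scheme.IdealSheafData
open Summit.ResolutionOfSingularities.ResolutionOfSingularities.Cruxes.EquisingularLift.StrataSplit

namespace Summit.ResolutionOfSingularities.ResolutionOfSingularities.Cruxes.EquisingularLiftNat.Sections

namespace Cone

variable (k : Type) [Field k] (G : MvPolynomial (Fin 3) k) {d : ℕ} (hG : G.IsHomogeneous d)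
  (hF : (rename Fin.succ G : MvPolynomial (Fin 4) k).IsHomogeneous d) (hd : 0 < d) (hGp : Prime G)
  (hreg : ∀ i : Fin 3, IsRegularRing (MvPolynomial (Fin 3) k ⧸
    Ideal.span {aeval (Function.update (X : Fin 3 → MvPolynomial (Fin 3) k) i 1) G}))

attribute [local instance] MvPolynomial.gradedAlgebra ProjBaseChange.algebraBase

/-! ## The chart rings and the blow-up chart rings are regular -/

include hreg in
/-- **The chart rings off the vertex are regular**: for `c ≠ 0`, `ChartRing F_d c ≅ k[y]/(1 + y₁ᵈ + y₂ᵈ)` is a regular ring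
(`d ≠ 0` in `k`). [folklore] -/
theorem isRegularRing_chartRing_of_ne_zero (c : Fin 4) (hc : c ≠ 0) :
    IsRegularRing (ChartRing (rename Fin.succ G : MvPolynomial (Fin 4) k) c hF) := by
  obtain ⟨θ, -⟩ := FermatCone.exists_chartQuotEquiv (rename Fin.succ G : MvPolynomial (Fin 4) k) hF c _ rfl
    (radical_span_dehomogenize_succ k G hreg c hc)
  haveI := isRegularRing_quotient_dehomogenize_succ k G hreg c hc
  exact IsRegularRing.of_ringEquiv θ.symm

include hG hGp hreg in
/-- **The blow-up chart rings over the vertex chart are regular**: for the centre `I = (x₁/x₀, x₂/x₀, x₃/x₀)` of `ChartRing F_d 0` and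
`b = x_a/x₀` (`a = 1, 2, 3`), the affine blowup algebra `(ChartRing F_d 0)[I/b]` is a regular ring — transported along
`ChartRing F_d 0 ≅ k[y]/(y₀ᵈ + y₁ᵈ + y₂ᵈ)` (`x_{j+1}/x₀ ↦ ȳ_j`) from `FermatCone.isRegularRing_vertexChart`. [folklore] -/
theorem isRegularRing_blowupAlgebra_tautVec (a : Fin (0 + 3 + 1)) (ha : 0 + 1 ≤ (a : ℕ)) :
    IsRegularRing (blowupAlgebra
      (Ideal.span (Set.range fun c' : {c' : Fin (0 + 3 + 1) // 0 + 1 ≤ (c' : ℕ)} =>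
        tautVec (rename Fin.succ G : MvPolynomial (Fin 4) k) 0 hF c'.1))
      (tautVec (rename Fin.succ G : MvPolynomial (Fin 4) k) 0 hF a)) := by
  have hrad : (Ideal.span {G}).radical = Ideal.span {G} := ((Ideal.span_singleton_prime hGp.ne_zero).mpr hGp).radical
  obtain ⟨θ, hθ⟩ := FermatCone.exists_chartQuotEquiv (rename Fin.succ G : MvPolynomial (Fin 4) k) hF 0 G
    (dehomogenize_zero_rename_succ k G) hrad
  simp only [Fin.succAbove_zero] at hθ
  obtain ⟨j, rfl⟩ : ∃ j : Fin 3, Fin.succ j = a := Fin.exists_succ_eq.mpr (by rintro rfl; simp at ha)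
  refine WhitneyCubic.isRegularRing_blowupAlgebra_of_ringEquiv θ _ _ ?_
  have hrange : (⇑θ.toRingHom ∘ fun c' : {c' : Fin (0 + 3 + 1) // 0 + 1 ≤ (c' : ℕ)} =>
      tautVec (rename Fin.succ G : MvPolynomial (Fin 4) k) 0 hF c'.1) '' Set.univ =
      (⇑(Ideal.Quotient.mk (Ideal.span {G})) ∘
        (MvPolynomial.X : Fin 3 → MvPolynomial (Fin 3) k)) '' Set.univ := by
    rw [Set.image_univ, Set.image_univ]
    ext q
    constructor
    · rintro ⟨⟨c', hc'⟩, rfl⟩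
      obtain ⟨i, rfl⟩ : ∃ i : Fin 3, Fin.succ i = c' := Fin.exists_succ_eq.mpr (by rintro rfl; simp at hc')
      exact ⟨i, (hθ i).symm⟩
    · rintro ⟨i, rfl⟩
      exact ⟨⟨i.succ, by simp [Fin.val_succ]⟩, hθ i⟩
  have hI : (Ideal.span (Set.range fun c' : {c' : Fin (0 + 3 + 1) // 0 + 1 ≤ (c' : ℕ)} =>
      tautVec (rename Fin.succ G : MvPolynomial (Fin 4) k) 0 hF c'.1)).map θ.toRingHom =
      (PointBlowup.originIdeal 2 k).map (Ideal.Quotient.mk (Ideal.span {G})) := by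
    change _ = Ideal.map _ (Ideal.span (Set.range MvPolynomial.X))
    rw [Ideal.map_span, Ideal.map_span, ← Set.image_univ, ← Set.image_comp, hrange, Set.image_comp, Set.image_univ]
  rw [hI]
  erw [hθ j]
  exact isRegularRing_vertexChart_of_isHomogeneous k G j hG hGp.ne_zero (hreg j)


/-! ## The kill-map centre `Λ = V₊(x₁, x₂, x₃)` (the vertex) and the hypersurface -/

section Kill

variable (fk : homogeneousSubmodule (Fin (0 + 3 + 1)) k →+*ᵍ homogeneousSubmodule (Fin (0 + 1)) k)
  (hfk' : HomogeneousIdeal.irrelevant (homogeneousSubmodule (Fin (0 + 1)) k) ≤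
    (HomogeneousIdeal.irrelevant (homogeneousSubmodule (Fin (0 + 3 + 1)) k)).map fk) (hfkC : ∀ a : k, fk (C a) = C a)
  (hfkX : ∀ i : Fin (0 + 3 + 1), fk (X i) = if h : (i : ℕ) < 0 + 1 then X ⟨i, h⟩ else 0)

include hfkC hfkX hG hd in
/-- **`V(Λ) ⊆ V₊(F) = ι(H)`** (`F = G(x₁,x₂,x₃) ∈ (x₁, x₂, x₃)` for `G` of positive degree): the E1 clause at level `0`. [folklore] -/
theorem support_subset_range :
    ((Proj.map fk hfk').ker.support : Set (Proj (homogeneousSubmodule (Fin (0 + 3 + 1)) k))) ⊆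
      Set.range (hypersurfaceι (rename Fin.succ G : MvPolynomial (Fin 4) k)).left := by
  intro x hx
  have hX : ∀ j : Fin 3, (X j.succ : MvPolynomial (Fin 4) k) ∈ x.asHomogeneousIdeal := fun j =>
    FermatCone.X_mem_of_mem_support k fk hfk' hfkC hfkX hx j.succ (by simp [Fin.val_succ])
  refine (Set.ext_iff.mp (range_hypersurfaceι (rename Fin.succ G : MvPolynomial (Fin 4) k)) x).mpr
    ((ProjectiveSpectrum.mem_zeroLocus _ _ _).mpr (Set.singleton_subset_iff.mpr ?_))
  change (rename Fin.succ G : MvPolynomial (Fin 4) k) ∈ x.asHomogeneousIdeal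
  exact (Ideal.span_le.mpr (Set.range_subset_iff.mpr hX)) (rename_succ_mem_span_X_succ k G hG hd)

include hfkC hfkX hF hGp in
/-- **`ι(H) ⊄ V(Λ)`**: the generic point `(F)` of `H` misses some `V₊(x_{a+1})`. [folklore] -/
theorem not_range_subset_support :
    ¬ (Set.range (hypersurfaceι (rename Fin.succ G : MvPolynomial (Fin 4) k)).left ⊆
      ((Proj.map fk hfk').ker.support : Set (Proj (homogeneousSubmodule (Fin (0 + 3 + 1)) k)))) := by
  intro h
  have hmem : (pointOfPrime (rename Fin.succ G : MvPolynomial (Fin 4) k) hF (prime_rename_succ k G hGp) :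
      Proj (homogeneousSubmodule (Fin (0 + 3 + 1)) k)) ∈ Set.range (hypersurfaceι (rename Fin.succ G : MvPolynomial (Fin 4) k)).left := by
    refine (Set.ext_iff.mp (range_hypersurfaceι (rename Fin.succ G : MvPolynomial (Fin 4) k)) _).mpr
      ((ProjectiveSpectrum.mem_zeroLocus _ _ _).mpr (Set.singleton_subset_iff.mpr ?_))
    exact Ideal.subset_span rfl
  obtain ⟨a, ha⟩ := exists_X_succ_not_mem_span k G hGp
  exact ha (FermatCone.X_mem_of_mem_support k fk hfk' hfkC hfkX (h hmem) a.succ (by simp [Fin.val_succ]))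

end Kill

/-! ## The centre on the chart `Spec (ChartRing F_d c) → ℙ³_k` -/

section Chart

variable (fk : homogeneousSubmodule (Fin (0 + 3 + 1)) k →+*ᵍ homogeneousSubmodule (Fin (0 + 1)) k)
  (hfk' : HomogeneousIdeal.irrelevant (homogeneousSubmodule (Fin (0 + 1)) k) ≤
    (HomogeneousIdeal.irrelevant (homogeneousSubmodule (Fin (0 + 3 + 1)) k)).map fk) (hfkC : ∀ a : k, fk (C a) = C a)
  (hfkX : ∀ i : Fin (0 + 3 + 1), fk (X i) = if h : (i : ℕ) < 0 + 1 then X ⟨i, h⟩ else 0)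
  (c : Fin 4)

/-- `Spec (ChartRing F_d c) → H_d ↪ ℙ³_k` is `Spec (k[x]_{(x_c)} → ChartRing F_d c)` followed by `D₊(x_c) ↪ ℙ³_k`
(`SmoothHypersurface.chart_hypersurfaceι` on underlying schemes). [folklore] -/
theorem chart_left_comp_ι :
    (chart (rename Fin.succ G : MvPolynomial (Fin 4) k) c hF hd).left ≫ (hypersurfaceι (rename Fin.succ G : MvPolynomial (Fin 4) k)).left =
      Spec.map (CommRingCat.ofHom (toChartRing (rename Fin.succ G : MvPolynomial (Fin 4) k) c hF).toRingHom) ≫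
        Proj.awayι (homogeneousSubmodule (Fin (2 + 1 + 1)) k) (X c) (X_mem c) one_pos := by
  have h := congrArg (fun f => f.left) (chart_hypersurfaceι (rename Fin.succ G : MvPolynomial (Fin 4) k) c hF hd)
  simp only [Over.comp_left, specOverOfAlgHom_left, awayChartι_left] at h
  exact h

set_option maxHeartbeats 400000 in
/-- **Pulling a section `b` of `D₊(x_c)` back to `Spec (ChartRing F_d c)`** gives `[b]` (through `Γ(Spec A, ⊤) ≅ A`). [folklore] -/
theorem appLE_chart_awayToSection
    (hle : (⊤ : (Spec (CommRingCat.of (ChartRing (rename Fin.succ G : MvPolynomial (Fin 4) k) c hF))).Opens) ≤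
      (Spec.map (CommRingCat.ofHom (toChartRing (rename Fin.succ G : MvPolynomial (Fin 4) k) c hF).toRingHom) ≫
        Proj.awayι (homogeneousSubmodule (Fin (2 + 1 + 1)) k) (X c) (X_mem c) one_pos) ⁻¹ᵁ
          Proj.basicOpen (homogeneousSubmodule (Fin (2 + 1 + 1)) k) (X c))
    (b : Away (homogeneousSubmodule (Fin (2 + 1 + 1)) k) (X c)) :
    ((Spec.map (CommRingCat.ofHom (toChartRing (rename Fin.succ G : MvPolynomial (Fin 4) k) c hF).toRingHom) ≫
        Proj.awayι (homogeneousSubmodule (Fin (2 + 1 + 1)) k) (X c) (X_mem c) one_pos).appLE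
        (Proj.basicOpen (homogeneousSubmodule (Fin (2 + 1 + 1)) k) (X c)) ⊤ hle).hom
        ((Proj.awayToSection (homogeneousSubmodule (Fin (2 + 1 + 1)) k) (X c)).hom b) =
      (Scheme.ΓSpecIso (CommRingCat.of (ChartRing (rename Fin.succ G : MvPolynomial (Fin 4) k) c hF))).inv.hom
        (toChartRing (rename Fin.succ G : MvPolynomial (Fin 4) k) c hF b) := by
  have happ : (Spec.map (CommRingCat.ofHom (toChartRing (rename Fin.succ G : MvPolynomial (Fin 4) k) c hF).toRingHom) ≫
        Proj.awayι (homogeneousSubmodule (Fin (2 + 1 + 1)) k) (X c) (X_mem c) one_pos).appLE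
        (Proj.basicOpen (homogeneousSubmodule (Fin (2 + 1 + 1)) k) (X c)) ⊤ hle =
      (Proj.awayι (homogeneousSubmodule (Fin (2 + 1 + 1)) k) (X c) (X_mem c) one_pos).appLE
          (Proj.basicOpen (homogeneousSubmodule (Fin (2 + 1 + 1)) k) (X c)) ⊤
          (ProjFrac.awayι_preimage_basicOpen_self (X_mem (R := k) c) one_pos).ge ≫
        (Spec.map (CommRingCat.ofHom (toChartRing (rename Fin.succ G : MvPolynomial (Fin 4) k) c hF).toRingHom)).appLE ⊤ ⊤ le_rfl :=
    (Scheme.Hom.appLE_comp_appLE _ _ _ _ _ _ _).symm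
  have htop : (Spec.map (CommRingCat.ofHom (toChartRing (rename Fin.succ G : MvPolynomial (Fin 4) k) c hF).toRingHom)).appLE ⊤ ⊤ le_rfl =
      (Spec.map (CommRingCat.ofHom (toChartRing (rename Fin.succ G : MvPolynomial (Fin 4) k) c hF).toRingHom)).appTop :=
    (Scheme.Hom.app_eq_appLE _).symm
  rw [happ, ProjFrac.appLE_awayι_eq_resAway, htop, CategoryTheory.ConcreteCategory.comp_apply,
    ProjFrac.resAway_awayToSection]
  have hnat := Scheme.ΓSpecIso_inv_naturality
    (CommRingCat.ofHom (toChartRing (rename Fin.succ G : MvPolynomial (Fin 4) k) c hF).toRingHom)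
  exact (congrArg (fun f => f.hom b) hnat).symm

include hfkC hfkX in
/-- **THE CENTRE ON THE CHART**: the pull-back of `Λ = ker Proj(f_k)` along `Spec (ChartRing F_d c) → H_d ↪ ℙ³_k` is the ideal sheaf of
`(x₁/x_c, x₂/x_c, x₃/x_c) ⊆ ChartRing F_d c` (`Limits.ideal_comap_eq_map`, `LinearCentre.ker_projMap_kill_ideal_basicOpen`,
`appLE_chart_awayToSection`). [folklore] -/
theorem comap_chart_eq_ofIdealTop :
    (((Proj.map fk hfk').ker.comap (hypersurfaceι (rename Fin.succ G : MvPolynomial (Fin 4) k)).left).comap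
        (chart (rename Fin.succ G : MvPolynomial (Fin 4) k) c hF hd).left :
        (Spec (CommRingCat.of (ChartRing (rename Fin.succ G : MvPolynomial (Fin 4) k) c hF))).IdealSheafData) =
      ofIdealTop ((Ideal.span (Set.range fun c' : {c' : Fin (0 + 3 + 1) // 0 + 1 ≤ (c' : ℕ)} =>
        tautVec (rename Fin.succ G : MvPolynomial (Fin 4) k) c hF c'.1)).map
        (Scheme.ΓSpecIso (CommRingCat.of (ChartRing (rename Fin.succ G : MvPolynomial (Fin 4) k) c hF))).inv.hom) := by
  haveI : IsAffine (Comma.left (specOver k (ChartRing (rename Fin.succ G : MvPolynomial (Fin 4) k) c hF))) :=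
    inferInstanceAs (IsAffine (Spec (CommRingCat.of (ChartRing (rename Fin.succ G : MvPolynomial (Fin 4) k) c hF))))
  set π := Spec.map (CommRingCat.ofHom (toChartRing (rename Fin.succ G : MvPolynomial (Fin 4) k) c hF).toRingHom) ≫
    Proj.awayι (homogeneousSubmodule (Fin (2 + 1 + 1)) k) (X c) (X_mem c) one_pos with hπ
  have hcomp : ((Proj.map fk hfk').ker.comap (hypersurfaceι (rename Fin.succ G : MvPolynomial (Fin 4) k)).left).comap
      (chart (rename Fin.succ G : MvPolynomial (Fin 4) k) c hF hd).left = (Proj.map fk hfk').ker.comap π := by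
    rw [← Scheme.IdealSheafData.comap_comp]
    exact congrArg (fun f => (Proj.map fk hfk').ker.comap f) (chart_left_comp_ι k G hF hd c)
  refine hcomp.trans ?_
  let D : (Proj (homogeneousSubmodule (Fin (0 + 3 + 1)) k)).affineOpens :=
    ⟨Proj.basicOpen (homogeneousSubmodule (Fin (0 + 3 + 1)) k) (X c),
      Proj.isAffineOpen_basicOpen _ (X c) (EquisingularLift.StrataSplit.LinearCentre.X_mem_one (r := 0) (m := 3) c) one_pos⟩
  have hV : ((⟨⊤, isAffineOpen_top _⟩ : (Spec (CommRingCat.of (ChartRing (rename Fin.succ G : MvPolynomial (Fin 4) k) c hF))).affineOpens) :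
      (Spec (CommRingCat.of (ChartRing (rename Fin.succ G : MvPolynomial (Fin 4) k) c hF))).Opens) = π ⁻¹ᵁ (D : (Proj _).Opens) := by
    change ⊤ = Spec.map _ ⁻¹ᵁ (Proj.awayι (homogeneousSubmodule (Fin (2 + 1 + 1)) k) (X c) (X_mem c) one_pos ⁻¹ᵁ
      Proj.basicOpen (homogeneousSubmodule (Fin (2 + 1 + 1)) k) (X c))
    rw [ProjFrac.awayι_preimage_basicOpen_self (X_mem (R := k) c) one_pos]
    rfl
  apply Scheme.IdealSheafData.ext_of_isAffine
  rw [ideal_ofIdealTop_top, Literature.AlgebraicGeometry.Limits.ideal_comap_eq_map π _ D _ hV,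
    EquisingularLift.StrataSplit.LinearCentre.ker_projMap_kill_ideal_basicOpen (r := 0) (m := 3) fk hfk' hfkC hfkX c, Ideal.map_span, Ideal.map_span,
    ← Set.range_comp, ← Set.range_comp]
  refine congrArg Ideal.span (congrArg Set.range (funext fun c' => ?_))
  simp only [Function.comp_apply]
  rw [appLE_chart_awayToSection]
  rfl

end Chart

/-! ## Every blow-up of `H_d` along `Λ · 𝒪_{H_d}` is regular -/

section Down

variable (fk : homogeneousSubmodule (Fin (0 + 3 + 1)) k →+*ᵍ homogeneousSubmodule (Fin (0 + 1)) k)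
  (hfk' : HomogeneousIdeal.irrelevant (homogeneousSubmodule (Fin (0 + 1)) k) ≤
    (HomogeneousIdeal.irrelevant (homogeneousSubmodule (Fin (0 + 3 + 1)) k)).map fk) (hfkC : ∀ a : k, fk (C a) = C a)
  (hfkX : ∀ i : Fin (0 + 3 + 1), fk (X i) = if h : (i : ℕ) < 0 + 1 then X ⟨i, h⟩ else 0)

include hfkC hfkX hG hF hd hGp hreg in
/-- **`Bl_vertex H_d` IS REGULAR, for every blow-up**: every blow-up `ρ : Z → H_d` of the Fermat cone along the trace `Λ · 𝒪_{H_d}` of the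
linear centre `Λ = V₊(x₁, x₂, x₃)` is a regular scheme (`k` algebraically closed, `d ≠ 0` in `k`). Over `D₊(x_c)` it is a blow-up of
`Spec (ChartRing F_d c)` along `(x₁/x_c, x₂/x_c, x₃/x_c)~`; for `c ≠ 0` that ideal is `(1)` and the blow-up is an isomorphism onto the regular
`Spec (ChartRing F_d c)`; for `c = 0` the charts at the generators (Stacks 0804) are spectra of regular rings. [folklore; Stacks 0804, GW 13.96] -/
theorem isRegular_of_isBlowup_comap (Z : Scheme.{0}) (ρ : Z ⟶ (hypersurface (rename Fin.succ G : MvPolynomial (Fin 4) k)).left)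
    (hρ : IsBlowup ρ (((Proj.map fk hfk').ker.comap (hypersurfaceι (rename Fin.succ G : MvPolynomial (Fin 4) k)).left))) : Scheme.IsRegular Z := by
  intro z
  obtain ⟨c, hc⟩ := WhitneyCubic.exists_mem_basicOpen k ((hypersurfaceι (rename Fin.succ G : MvPolynomial (Fin 4) k)).left (ρ z))
  let U : (hypersurface (rename Fin.succ G : MvPolynomial (Fin 4) k)).left.Opens :=
    (hypersurfaceι (rename Fin.succ G : MvPolynomial (Fin 4) k)).left ⁻¹ᵁ Proj.basicOpen (homogeneousSubmodule (Fin (2 + 1 + 1)) k) (X c)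
  have hzU : ρ z ∈ U := hc
  have hrange : Set.range (chart (rename Fin.succ G : MvPolynomial (Fin 4) k) c hF hd).left = Set.range U.ι := by
    rw [range_chart_left, Scheme.Opens.range_ι]
  let e := IsOpenImmersion.isoOfRangeEq (chart (rename Fin.succ G : MvPolynomial (Fin 4) k) c hF hd).left U.ι hrange
  have he : e.hom ≫ U.ι = (chart (rename Fin.succ G : MvPolynomial (Fin 4) k) c hF hd).left :=
    IsOpenImmersion.isoOfRangeEq_hom_fac _ _ _
  -- the restricted blow-up, moved to `Spec (ChartRing F c)`
  have hρU : IsBlowup ((ρ ∣_ U) ≫ e.symm.hom) (ofIdealTop ((Ideal.span (Set.range fun c' : {c' : Fin (0 + 3 + 1) // 0 + 1 ≤ (c' : ℕ)} =>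
      tautVec (rename Fin.succ G : MvPolynomial (Fin 4) k) c hF c'.1)).map
      (Scheme.ΓSpecIso (CommRingCat.of (ChartRing (rename Fin.succ G : MvPolynomial (Fin 4) k) c hF))).inv.hom)) := by
    have h := (hρ.restrict U).comp_iso e.symm
    rw [← Scheme.IdealSheafData.comap_comp, Iso.symm_inv, he] at h
    exact WhitneyCubic.isBlowup_of_ideal_eq h (comap_chart_eq_ofIdealTop k G hF hd fk hfk' hfkC hfkX c)
  -- the stalk of `Z` at `z` is the stalk of the open piece `ρ⁻¹ U` at `⟨z, _⟩`
  haveI : IsIso ((ρ ⁻¹ᵁ U).ι.stalkMap ⟨z, hzU⟩) := inferInstance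
  suffices hst : IsRegularLocalRing ((↑(ρ ⁻¹ᵁ U) : Scheme.{0}).presheaf.stalk ⟨z, hzU⟩) from by
    haveI := hst
    exact IsRegularLocalRing.of_ringEquiv (asIso ((ρ ⁻¹ᵁ U).ι.stalkMap ⟨z, hzU⟩)).commRingCatIsoToRingEquiv.symm
  by_cases hc0 : c = 0
  · -- `c = 0`: the charts at the generators are spectra of regular rings
    subst hc0
    obtain ⟨j, φ, hφ, hzφ, -⟩ := IsBlowup.exists_chart_of_span_range_eq hρU
      (fun c' : {c' : Fin (0 + 3 + 1) // 0 + 1 ≤ (c' : ℕ)} => tautVec (rename Fin.succ G : MvPolynomial (Fin 4) k) 0 hF c'.1) rfl ⟨z, hzU⟩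
    obtain ⟨w, hw⟩ := hzφ
    haveI := isRegularRing_blowupAlgebra_tautVec k G hG hF hGp hreg j.1 j.2
    by_contra hz
    rw [← hw] at hz
    exact not_isRegularLocalRing_localization_of_stalk φ w hz inferInstance
  · -- `c ≠ 0`: the centre is the unit ideal, the blow-up is an isomorphism onto the regular `Spec (ChartRing F c)`
    have hc1 : 0 + 1 ≤ (c : ℕ) := by
      have : (c : ℕ) ≠ 0 := fun h => hc0 (Fin.ext h)
      omega
    have htop : Ideal.span (Set.range fun c' : {c' : Fin (0 + 3 + 1) // 0 + 1 ≤ (c' : ℕ)} =>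
        tautVec (rename Fin.succ G : MvPolynomial (Fin 4) k) c hF c'.1) = ⊤ :=
      Ideal.eq_top_of_isUnit_mem _ (Ideal.subset_span ⟨⟨c, hc1⟩, rfl⟩)
        (by rw [show (fun c' : {c' : Fin (0 + 3 + 1) // 0 + 1 ≤ (c' : ℕ)} => tautVec (rename Fin.succ G : MvPolynomial (Fin 4) k) c hF c'.1)
          ⟨c, hc1⟩ = tautVec (rename Fin.succ G : MvPolynomial (Fin 4) k) c hF c from rfl, tautVec_self]; exact isUnit_one)
    have hI : ofIdealTop ((Ideal.span (Set.range fun c' : {c' : Fin (0 + 3 + 1) // 0 + 1 ≤ (c' : ℕ)} =>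
        tautVec (rename Fin.succ G : MvPolynomial (Fin 4) k) c hF c'.1)).map
        (Scheme.ΓSpecIso (CommRingCat.of (ChartRing (rename Fin.succ G : MvPolynomial (Fin 4) k) c hF))).inv.hom) = ⊤ := by
      rw [htop, Ideal.map_top]
      exact Scheme.IdealSheafData.ext_of_isAffine (by rw [ideal_ofIdealTop_top]; rfl)
    have hρU' : IsBlowup ((ρ ∣_ U) ≫ e.symm.hom)
        (⊤ : (Spec (CommRingCat.of (ChartRing (rename Fin.succ G : MvPolynomial (Fin 4) k) c hF))).IdealSheafData) := by
      rw [← hI]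
      exact hρU
    haveI : IsIso ((ρ ∣_ U) ≫ e.symm.hom) := hρU'.isIso isEffectiveCartier_top
    haveI : IsRegularRing (ChartRing (rename Fin.succ G : MvPolynomial (Fin 4) k) c hF) := isRegularRing_chartRing_of_ne_zero k G hF hreg c hc0
    haveI : IsRegularLocalRing ((Spec (CommRingCat.of (ChartRing (rename Fin.succ G : MvPolynomial (Fin 4) k) c hF))).presheaf.stalk
        (((ρ ∣_ U) ≫ e.symm.hom) ⟨z, hzU⟩)) :=
      Scheme.isRegular_Spec (CommRingCat.of (ChartRing (rename Fin.succ G : MvPolynomial (Fin 4) k) c hF)) (((ρ ∣_ U) ≫ e.symm.hom) ⟨z, hzU⟩)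
    exact IsRegularLocalRing.of_ringEquiv
      (R := (Spec (CommRingCat.of (ChartRing (rename Fin.succ G : MvPolynomial (Fin 4) k) c hF))).presheaf.stalk (((ρ ∣_ U) ≫ e.symm.hom) ⟨z, hzU⟩))
      (asIso (((ρ ∣_ U) ≫ e.symm.hom).stalkMap ⟨z, hzU⟩)).commRingCatIsoToRingEquiv

end Down

/-! ## EL♮ for cones over smooth plane curves -/

/-- **EL♮ HOLDS FOR THE CONE OVER EVERY SMOOTH PLANE CURVE**: for `G ∈ K[T₀,T₁,T₂]` prime and homogeneous of degree `d` whose three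
affine charts `K[T]/(G|_{Tᵢ := 1})` are regular rings (the plane curve `V₊(G)` is smooth), the cone `H = V₊(G(x₁,x₂,x₃)) ⊂ ℙ³_K`
(`K` algebraically closed of characteristic `p`) satisfies `Theorems.EquisingularLift.ELNatAt p K 3 H ι` (p503491). Witnesses: `O = 𝕎(K)`,
ONE blow-up of `ℙ³_O` along the `O`-point `V(x₁, x₂, x₃)` = the section through the vertex (`elNatAt_of_oneStep₀` p505461, kill map
`(r, m) = (0, 3)`); downstairs every blow-up of `H` along `Λ · 𝒪_H` is regular (`isRegular_of_isBlowup_comap`). The Fermat cones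
(`FermatCone.elNatAt_fermatCone`, p518711) are the instance `G = T₀ᵈ + T₁ᵈ + T₂ᵈ`. [OURS · L1 W4.5b] [folklore] -/
theorem elNatAt_cone (p : ℕ) (hp : p.Prime) (K : Type) [Field K] [CharP K p] [IsAlgClosed K]
    (G : MvPolynomial (Fin 3) K) {d : ℕ} (hG : G.IsHomogeneous d) (hGp : Prime G)
    (hreg : ∀ i : Fin 3, IsRegularRing (MvPolynomial (Fin 3) K ⧸
      Ideal.span {aeval (Function.update (X : Fin 3 → MvPolynomial (Fin 3) K) i 1) G})) :
    Theorems.EquisingularLift.ELNatAt p K 3 (hypersurface (rename Fin.succ G : MvPolynomial (Fin 4) K)).left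
      (hypersurfaceι (rename Fin.succ G : MvPolynomial (Fin 4) K)).left := by
  classical
  have hF : (rename Fin.succ G : MvPolynomial (Fin 4) K).IsHomogeneous d := isHomogeneous_rename_succ K G hG
  have hd : 0 < d := pos_of_prime K G hG hGp
  obtain ⟨O, i1, i2, i3, i4, -, -, π, hπ⟩ := stub_wittRing p hp K
  obtain ⟨fO, hfO', hfOC, hfOX⟩ := EquisingularLift.StrataSplit.LinearCentre.exists_kill O 0 3
  obtain ⟨fk, hfk', hfkC, hfkX⟩ := EquisingularLift.StrataSplit.LinearCentre.exists_kill K 0 3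
  haveI := isIntegral_hypersurface_cone K G hG hGp
  -- the centre `C = ker Proj(f_O)`: regular (`≅ ℙ⁰_O`) and `O`-flat — as in `LinearCentre.EL_of_linearCentre`
  obtain ⟨hsmr, -⟩ := stub_projectiveAmbientSmoothProper O 0
  set iO : Proj (homogeneousSubmodule (Fin (0 + 1)) O) ⟶ Proj (homogeneousSubmodule (Fin (0 + 3 + 1)) O) :=
    Proj.map fO hfO' with hiOdef
  haveI : IsClosedImmersion iO :=
    Literature.AlgebraicGeometry.FundamentalGroup.isClosedImmersion_projMap_of_surjective fO hfO'
      (EquisingularLift.StrataSplit.LinearCentre.kill_surjective (r := 0) (m := 3) fO.toRingHom (fun a => hfOC a) (fun i => hfOX i))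
  have hRr : Scheme.IsRegular (Proj (homogeneousSubmodule (Fin (0 + 1)) O)) := fun y =>
    (stub_goodAtOfSmooth O _ _ hsmr y).1
  have hCreg : Scheme.IsRegular iO.ker.subscheme := hRr.of_iso iO.toImage
  have hCflat : Flat (iO.ker.subschemeι ≫ Proj.toSpecZero (homogeneousSubmodule (Fin (0 + 3 + 1)) O) ≫
      Spec.map (CommRingCat.ofHom (algebraMap O (homogeneousSubmodule (Fin (0 + 3 + 1)) O 0)))) := by
    have h1 : iO.toImage ≫ iO.ker.subschemeι ≫ (Proj.toSpecZero (homogeneousSubmodule (Fin (0 + 3 + 1)) O) ≫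
        Spec.map (CommRingCat.ofHom (algebraMap O (homogeneousSubmodule (Fin (0 + 3 + 1)) O 0)))) =
        Proj.toSpecZero (homogeneousSubmodule (Fin (0 + 1)) O) ≫
          Spec.map (CommRingCat.ofHom (algebraMap O (homogeneousSubmodule (Fin (0 + 1)) O 0))) := by
      rw [← Category.assoc]
      change (iO.toImage ≫ iO.imageι) ≫ _ = _
      rw [Scheme.Hom.toImage_imageι]
      exact EquisingularLift.StrataSplit.LinearCentre.projMap_kill_comp_structureMap (r := 0) (m := 3) fO hfO' hfOC hfOX
    haveI := hsmr
    have h2 : Flat (iO.toImage ≫ iO.ker.subschemeι ≫ (Proj.toSpecZero (homogeneousSubmodule (Fin (0 + 3 + 1)) O) ≫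
        Spec.map (CommRingCat.ofHom (algebraMap O (homogeneousSubmodule (Fin (0 + 3 + 1)) O 0))))) := by
      rw [h1]; infer_instance
    exact (MorphismProperty.cancel_left_of_respectsIso @Flat iO.toImage _).mp h2
  -- `n` is spelled `0 + 3` so that `Fin (n + 1)` is literally the kill maps' `Fin (0 + 3 + 1)` (cheap unification)
  refine elNatAt_of_oneStep₀ K (0 + 3) _ (hypersurfaceι (rename Fin.succ G : MvPolynomial (Fin 4) K)).left O π hπ iO.ker hCreg hCflat
    (Proj.map fk hfk').ker ?_ ?_ ?_ ?_
  · intro φ hφ' hφ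
    exact EquisingularLift.StrataSplit.LinearCentre.comap_ker_projMap_kill (r := 0) (m := 3) π hπ φ hφ hφ' fO hfO' hfOC hfOX fk hfk' hfkC hfkX
  · exact not_range_subset_support K G hF hGp fk hfk' hfkC hfkX
  · exact support_subset_range K G hG hd fk hfk' hfkC hfkX
  · intro Z ρ hρ
    exact isRegular_of_isBlowup_comap K G hG hF hd hGp hreg fk hfk' hfkC hfkX Z ρ hρ

end Cone

end Summit.ResolutionOfSingularities.ResolutionOfSingularities.Cruxes.EquisingularLiftNat.Sections

end
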